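import Summits.CriticalPhenomena.PercolationContinuityZ3.Theorems.PercNearOneGluingNoHeavyLowerTailFKStarHTools
import HarnessLib

/-!
# FK sub-lane: hp-8's Lemma (★^H) ((K7) of PROOF-S5-ALL-R) for the random-cluster measure `φ_{𝐩,q}`, `q ≥ 1`

Support file (`--supports stmt-CriticalPhenomena-4575`), FK sub-lane `prim-bschramm-fk-2` (gen 3); builds on p205010 (kernel theorem,
internal audit signed; external expert review pending).  No definitions, no named facts, no sorries; standard axioms.

`FK.starH_indicator_rc`: for `φ = rcMeasureW u q ∅`, `q ≥ 1`, an owner `x ∈ S` (finite set of sources/decoys), an observer `v`, a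
vertex set `N`, and an increasing family `U` (test function `Ψ = 1_U` of `C_x`):
  `Y^H(N) · φ(S ↮ v) ≤ φ(S ↮ v, N ↮ v) · Cov_φ(1_U(C_x), 1{S ↔ v})`,
where `Y^H(N) = Σ_ω φ{ω} 1{x, v ∉ N ∪ V(C_N(ω))} · Cov_{φ_{u − C̄_N(ω)}}(1_U(C_x), 1{S ↔ v})` is the expected WORLD covariance off
the cluster of `N` (the world = the random-cluster measure with the pairs meeting the vertex cluster of `N` deleted, same `q`,
vdBHK Lemma 2.3).  At `q = 1` this is prove-1's `CovTauStarN.starH_ED` (p203777-lineage); it is the base input `(★^H)` of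
Lemma `Δ_N^S` / `T^S ≥ 0` for `φ_{𝐩,q}` (bschramm/FK-Q2.md §12.6(c)).  Proof = hp-8's (K7) in the class language of this cell's
Lemma `P_v` (`…FKHullPortPv.lean`): law of total covariance along `σ(C_N)` (`FK.starH_world_eq`; off `{x, v ∉ C_N}` the bracket
vanishes because `C_x` resp. `{S ↔ v}` is decided, `FK.openEdgeCluster_eq_of_setCl_eq_of_joined`,
`FK.reachable_iff_of_setCl_eq_of_joined`), reindexing (`FK.sum_rcMass_mul_condProb_key`), `1{S↔v} = 1{S∪N ↔ v} − 1{N ↔ v, S ↮ v}`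
classwise, Gladkov's tree Harris along the exploration of `C_N` (`FK.setClusterHarris_rc`) and vdBHK Thm 1.4 with the set `S`
(`FK.real_clusterEvent_setReach_mul_le`).
[cite: Gladkov2024, Thm. 3.2 (p. 4)] [cite: VandenbergHaggstromKahn2005, Thm. 1.4 (p. 7), Thm. 2.1 (p. 9), §2.1 Lemmas 2.3–2.4 (p. 10)]
[cite: Grimmett2006, Thm. (3.8)(b) (p. 39)]
-/

noncomputable section

namespace Summit.CriticalPhenomena.PercolationContinuityZ3.Theorems.FK

open MeasureTheory Set
open Literature.Probability.LatticeModels Literature.Probability.Percolation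
open Literature.Probability.Percolation.DecisionTree (ind ind_of_mem ind_of_not_mem ind_nonneg)
open Literature.Probability.Percolation.BHK2006 (rcMass rcMass_nonneg sum_rcMass delW setCl barOf rcMass_fkg
  rcMeasureW_real_eq_sum_rcMass openEdgeCluster_mono ind_inter setCl_mono setIntegral_rcMeasureW_eq_sum)
open Literature.Probability.Percolation.KNPreFKG
open Summit.CriticalPhenomena.PercolationContinuityZ3.Theorems.HullPort (cut avoidEv cut_eq_barOf)
open scoped Classical

variable {V : Type*} [Fintype V]

/-- **Law of total covariance along `σ(C_N)`** (the first half of hp-8's (K7) for `φ_{𝐩,q}`, `q > 0`): with `A = {C_x ∈ U}`,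
`Y = {S ↔ v}` and the classes `E_ω = {C_N = C_N(ω)}`,
`Y^H(N) = Σ_ω φ{ω} 1{N ↮ x, N ↮ v} Cov_{φ_{u − cut_N(ω)}}(1_A, 1_Y) = φ(A ∩ Y) − Σ_ω φ{ω} φ(A | E_ω) φ(Y | E_ω)`:
on `{N ↮ x, N ↮ v}` the world covariance is the conditional covariance given the class (`FK.starH_world_eq`), elsewhere the
conditional covariance vanishes (`C_x` resp. `{S ↔ v}` is decided by `C_N`), and `Σ_ω φ{ω} φ(A ∩ Y | E_ω) = φ(A ∩ Y)`.
[cite: VandenbergHaggstromKahn2005, §2.1 Lemmas 2.3–2.4 (p. 10)] [cite: Gladkov2024, §2] -/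
theorem starH_sum_eq (u : Sym2 V → unitInterval) {q : ℝ} (hq0 : 0 < q) (x v : V) (S N : Set V)
    (U : Set (Set (Sym2 V))) :
    (∑ ω, rcMass u q ω * (ind {ω : BondConfig V | (∀ n ∈ N, ¬ (openGraph ω).Reachable n x) ∧
          ∀ n ∈ N, ¬ (openGraph ω).Reachable n v} ω *
        ((∑ η, rcMass (delW u (cut N ω)) q η * (U.indicator (1 : Set (Sym2 V) → ℝ) (openEdgeCluster η x) *
            ind {ζ : BondConfig V | ∃ s ∈ S, (openGraph ζ).Reachable s v} η)) -
          (∑ η, rcMass (delW u (cut N ω)) q η * U.indicator (1 : Set (Sym2 V) → ℝ) (openEdgeCluster η x)) *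
            (∑ η, rcMass (delW u (cut N ω)) q η * ind {ζ : BondConfig V | ∃ s ∈ S, (openGraph ζ).Reachable s v} η)))) =
      (rcMeasureW u q ∅).real ({η : BondConfig V | openEdgeCluster η x ∈ U} ∩
          {ζ : BondConfig V | ∃ s ∈ S, (openGraph ζ).Reachable s v}) -
        ∑ ω, rcMass u q ω *
          ((rcMeasureW u q ∅).real ({η : BondConfig V | openEdgeCluster η x ∈ U} ∩ {ζ : BondConfig V | setCl ζ N = setCl ω N}) /
              (rcMeasureW u q ∅).real {ζ : BondConfig V | setCl ζ N = setCl ω N} *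
            ((rcMeasureW u q ∅).real ({ζ : BondConfig V | ∃ s ∈ S, (openGraph ζ).Reachable s v} ∩
                {ζ : BondConfig V | setCl ζ N = setCl ω N}) /
              (rcMeasureW u q ∅).real {ζ : BondConfig V | setCl ζ N = setCl ω N})) := by
  classical
  haveI := isProbabilityMeasure_rcMeasureW u hq0 (∅ : Set V)
  set A : Set (BondConfig V) := {η : BondConfig V | openEdgeCluster η x ∈ U} with hA
  set Y : Set (BondConfig V) := {ζ : BondConfig V | ∃ s ∈ S, (openGraph ζ).Reachable s v} with hY
  set Nv : Set (BondConfig V) := {ζ : BondConfig V | ∃ n ∈ N, (openGraph ζ).Reachable n v} with hNv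
  set G : Set (BondConfig V) := {ω : BondConfig V | (∀ n ∈ N, ¬ (openGraph ω).Reachable n x) ∧
    ∀ n ∈ N, ¬ (openGraph ω).Reachable n v} with hG
  set E : BondConfig V → Set (BondConfig V) := fun ω => {ζ | setCl ζ N = setCl ω N} with hE
  have hmeas : ∀ T : Set (BondConfig V), MeasurableSet T := fun _ => MeasurableSet.of_discrete
  have hn := fun (T : Set (BondConfig V)) => (measureReal_nonneg : 0 ≤ (rcMeasureW u q ∅).real T)
  have hgA : ∀ η : BondConfig V, U.indicator (1 : Set (Sym2 V) → ℝ) (openEdgeCluster η x) = ind A η :=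
    indicator_one_openEdgeCluster U x
  set cp : Set (BondConfig V) → BondConfig V → ℝ := fun T ω =>
    (rcMeasureW u q ∅).real (T ∩ E ω) / (rcMeasureW u q ∅).real (E ω) with hcp
  have hmass : ∀ ω, (rcMeasureW u q ∅).real {ω} = rcMass u q ω := fun ω => by
    rw [rcMeasureW_real_singleton u hq0]; rfl
  have hEpos : ∀ ω, rcMass u q ω ≠ 0 → 0 < (rcMeasureW u q ∅).real (E ω) := by
    intro ω hne
    have hle : (rcMeasureW u q ∅).real {ω} ≤ (rcMeasureW u q ∅).real (E ω) :=
      measureReal_mono (Set.singleton_subset_iff.2 rfl) (measure_ne_top _ _)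
    rw [hmass] at hle
    exact lt_of_lt_of_le (lt_of_le_of_ne (rcMass_nonneg u hq0 ω) (Ne.symm hne)) hle
  /- 1. on `G`, the world covariance is the conditional covariance given the class -/
  have hworld : ∀ ω, ω ∈ G → rcMass u q ω ≠ 0 →
      (∑ η, rcMass (delW u (cut N ω)) q η * (U.indicator (1 : Set (Sym2 V) → ℝ) (openEdgeCluster η x) * ind Y η)) -
        (∑ η, rcMass (delW u (cut N ω)) q η * U.indicator (1 : Set (Sym2 V) → ℝ) (openEdgeCluster η x)) *
          (∑ η, rcMass (delW u (cut N ω)) q η * ind Y η) = cp (A ∩ Y) ω - cp A ω * cp Y ω := by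
    intro ω hωG hne
    have h := starH_world_eq u hq0 x v S N U hωG.1 hωG.2 hne
    simp only [hcp]
    exact h
  /- 2. off `G`, the conditional covariance vanishes (`C_x` or `{S ↔ v}` is decided by `C_N`) -/
  have hconst : ∀ ω, ω ∉ G → rcMass u q ω ≠ 0 → cp (A ∩ Y) ω - cp A ω * cp Y ω = 0 := by
    intro ω hωG hne
    have hEp := hEpos ω hne
    by_cases hxr : ∃ n ∈ N, (openGraph ω).Reachable n x
    · -- `A` is constant on the class
      have hAcl : ∀ ζ, ζ ∈ E ω → (ζ ∈ A ↔ ω ∈ A) := by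
        intro ζ hζ
        have hζ' : setCl ζ N = setCl ω N := hζ
        simp only [hA, Set.mem_setOf_eq, openEdgeCluster_eq_of_setCl_eq_of_joined hζ' hxr]
      by_cases hωA : ω ∈ A
      · have h1 : A ∩ Y ∩ E ω = Y ∩ E ω := by
          ext ζ; constructor
          · rintro ⟨⟨-, h2⟩, h3⟩; exact ⟨h2, h3⟩
          · rintro ⟨h2, h3⟩; exact ⟨⟨(hAcl ζ h3).2 hωA, h2⟩, h3⟩
        have h2 : A ∩ E ω = E ω := by
          ext ζ; constructor
          · rintro ⟨-, h3⟩; exact h3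
          · intro h3; exact ⟨(hAcl ζ h3).2 hωA, h3⟩
        simp only [hcp, h1, h2, div_self hEp.ne']; ring
      · have h1 : A ∩ Y ∩ E ω = ∅ := by
          rw [Set.eq_empty_iff_forall_notMem]
          rintro ζ ⟨⟨hζA, -⟩, hζE⟩; exact hωA ((hAcl ζ hζE).1 hζA)
        have h2 : A ∩ E ω = ∅ := by
          rw [Set.eq_empty_iff_forall_notMem]
          rintro ζ ⟨hζA, hζE⟩; exact hωA ((hAcl ζ hζE).1 hζA)
        simp only [hcp, h1, h2, measureReal_empty, zero_div]; ring
    · have hvr : ∃ n ∈ N, (openGraph ω).Reachable n v := by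
        by_contra hcon
        apply hωG
        refine ⟨fun n hn' h => hxr ⟨n, hn', h⟩, fun n hn' h => hcon ⟨n, hn', h⟩⟩
      -- `Y` is constant on the class
      have hYcl : ∀ ζ, ζ ∈ E ω → (ζ ∈ Y ↔ ω ∈ Y) := by
        intro ζ hζ
        have hζ' : setCl ζ N = setCl ω N := hζ
        have hr := reachable_iff_of_setCl_eq_of_joined hζ' hvr
        simp only [hY, Set.mem_setOf_eq]
        constructor
        · rintro ⟨s, hs, h⟩; exact ⟨s, hs, ((hr s).1 h.symm).symm⟩
        · rintro ⟨s, hs, h⟩; exact ⟨s, hs, ((hr s).2 h.symm).symm⟩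
      by_cases hωY : ω ∈ Y
      · have h1 : A ∩ Y ∩ E ω = A ∩ E ω := by
          ext ζ; constructor
          · rintro ⟨⟨h2, -⟩, h3⟩; exact ⟨h2, h3⟩
          · rintro ⟨h2, h3⟩; exact ⟨⟨h2, (hYcl ζ h3).2 hωY⟩, h3⟩
        have h2 : Y ∩ E ω = E ω := by
          ext ζ; constructor
          · rintro ⟨-, h3⟩; exact h3
          · intro h3; exact ⟨(hYcl ζ h3).2 hωY, h3⟩
        simp only [hcp, h1, h2, div_self hEp.ne']; ring
      · have h1 : A ∩ Y ∩ E ω = ∅ := by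
          rw [Set.eq_empty_iff_forall_notMem]
          rintro ζ ⟨⟨-, hζY⟩, hζE⟩; exact hωY ((hYcl ζ hζE).1 hζY)
        have h2 : Y ∩ E ω = ∅ := by
          rw [Set.eq_empty_iff_forall_notMem]
          rintro ζ ⟨hζY, hζE⟩; exact hωY ((hYcl ζ hζE).1 hζY)
        simp only [hcp, h1, h2, measureReal_empty, zero_div]; ring
  /- the left-hand sum is `Σ_ω φ{ω} [cp(A∩Y) − cp(A) cp(Y)]` -/
  have hL : ∑ ω, rcMass u q ω * (ind G ω *
      ((∑ η, rcMass (delW u (cut N ω)) q η * (U.indicator (1 : Set (Sym2 V) → ℝ) (openEdgeCluster η x) * ind Y η)) -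
        (∑ η, rcMass (delW u (cut N ω)) q η * U.indicator (1 : Set (Sym2 V) → ℝ) (openEdgeCluster η x)) *
          (∑ η, rcMass (delW u (cut N ω)) q η * ind Y η))) =
      ∑ ω, rcMass u q ω * (cp (A ∩ Y) ω - cp A ω * cp Y ω) := by
    refine Finset.sum_congr rfl fun ω _ => ?_
    by_cases hne : rcMass u q ω = 0
    · rw [hne]; ring
    by_cases hωG : ω ∈ G
    · rw [ind_of_mem hωG, one_mul, hworld ω hωG hne]
    · rw [ind_of_not_mem hωG, zero_mul, mul_zero, hconst ω hωG hne, mul_zero]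
  rw [hL]
  have hsum1 : ∑ ω, rcMass u q ω * cp (A ∩ Y) ω = (rcMeasureW u q ∅).real (A ∩ Y) := by
    have h := sum_rcMass_mul_condProb_key u hq0 (fun ζ : BondConfig V => setCl ζ N) (A ∩ Y) (fun _ => (1 : ℝ))
      (fun _ _ _ => rfl)
    simp only [one_mul] at h
    rw [hcp]; simp only
    rw [h, ← rcMeasureW_real_eq_sum_rcMass u hq0]
  have hsplit : ∑ ω, rcMass u q ω * (cp (A ∩ Y) ω - cp A ω * cp Y ω) =
      ∑ ω, rcMass u q ω * cp (A ∩ Y) ω - ∑ ω, rcMass u q ω * (cp A ω * cp Y ω) := by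
    rw [← Finset.sum_sub_distrib]; refine Finset.sum_congr rfl fun ω _ => ?_; ring
  rw [hsplit, hsum1]

/-- **`Y^H(N) ≤ Cov(1_U(C_x), 1{S ↔ v})`** (PROOF-S5-ALL-R (K7) Corollary, for `φ_{𝐩,q}`, `q ≥ 1`): by the law of total covariance
(`FK.starH_sum_eq`) and the cluster-conditional Harris inequality along `σ(C_N)` for the increasing events `A`, `Y`
(`FK.setClusterHarris_rc`). [cite: Gladkov2024, Thm. 3.2 (p. 4)] [cite: VandenbergHaggstromKahn2005, §2.1 Lemmas 2.3–2.4 (p. 10)] -/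
theorem starH_le_cov_indicator_rc (u : Sym2 V → unitInterval) {q : ℝ} (hq : 1 ≤ q) (x v : V) (S N : Set V)
    (U : Set (Set (Sym2 V))) (hU : IsUpperSet U) :
    (∑ ω, rcMass u q ω * (ind {ω : BondConfig V | (∀ n ∈ N, ¬ (openGraph ω).Reachable n x) ∧
          ∀ n ∈ N, ¬ (openGraph ω).Reachable n v} ω *
        ((∑ η, rcMass (delW u (cut N ω)) q η * (U.indicator (1 : Set (Sym2 V) → ℝ) (openEdgeCluster η x) *
            ind {ζ : BondConfig V | ∃ s ∈ S, (openGraph ζ).Reachable s v} η)) -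
          (∑ η, rcMass (delW u (cut N ω)) q η * U.indicator (1 : Set (Sym2 V) → ℝ) (openEdgeCluster η x)) *
            (∑ η, rcMass (delW u (cut N ω)) q η * ind {ζ : BondConfig V | ∃ s ∈ S, (openGraph ζ).Reachable s v} η)))) ≤
      (rcMeasureW u q ∅).real ({η : BondConfig V | openEdgeCluster η x ∈ U} ∩
          {ζ : BondConfig V | ∃ s ∈ S, (openGraph ζ).Reachable s v}) -
        (rcMeasureW u q ∅).real {η : BondConfig V | openEdgeCluster η x ∈ U} *
          (rcMeasureW u q ∅).real {ζ : BondConfig V | ∃ s ∈ S, (openGraph ζ).Reachable s v} := by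
  classical
  have hq0 : 0 < q := one_pos.trans_le hq
  haveI := isProbabilityMeasure_rcMeasureW u hq0 (∅ : Set V)
  rw [starH_sum_eq u hq0 x v S N U]
  have hAup : IsUpperSet {η : BondConfig V | openEdgeCluster η x ∈ U} := fun ω ω' hle hω => hU (openEdgeCluster_mono hle x) hω
  have hYup : IsUpperSet {ζ : BondConfig V | ∃ s ∈ S, (openGraph ζ).Reachable s v} :=
    fun ω ω' hle ⟨s, hs, h⟩ => ⟨s, hs, h.mono (openGraph_mono hle)⟩
  have hmass : ∀ ω, (rcMeasureW u q ∅).real {ω} = rcMass u q ω := fun ω => by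
    rw [rcMeasureW_real_singleton u hq0]; rfl
  have h := setClusterHarris_rc u hq ∅ N.toFinset hAup hYup
  simp only [Set.coe_toFinset, hmass] at h
  have h' : (rcMeasureW u q ∅).real {η : BondConfig V | openEdgeCluster η x ∈ U} *
      (rcMeasureW u q ∅).real {ζ : BondConfig V | ∃ s ∈ S, (openGraph ζ).Reachable s v} ≤
      ∑ ω, rcMass u q ω *
        ((rcMeasureW u q ∅).real ({η : BondConfig V | openEdgeCluster η x ∈ U} ∩ {ζ : BondConfig V | setCl ζ N = setCl ω N}) /
            (rcMeasureW u q ∅).real {ζ : BondConfig V | setCl ζ N = setCl ω N} *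
          ((rcMeasureW u q ∅).real ({ζ : BondConfig V | ∃ s ∈ S, (openGraph ζ).Reachable s v} ∩
              {ζ : BondConfig V | setCl ζ N = setCl ω N}) /
            (rcMeasureW u q ∅).real {ζ : BondConfig V | setCl ζ N = setCl ω N})) := by
    refine le_of_le_of_eq h ?_
    refine Finset.sum_congr rfl fun ω _ => ?_
    ring
  linarith

/-- **Lemma (★^H) for `φ_{𝐩,q}`, `q ≥ 1`, indicator test functions** (hp-8, PROOF-S5-ALL-R (K7), for the random-cluster measure):
for `x ∈ S`, an observer `v`, a source set `N` and an increasing family `U`,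
`Y^H(N) · φ(S ↮ v) ≤ φ(S ↮ v, N ↮ v) · Cov(1_U(C_x), 1{S ↔ v})` with
`Y^H(N) = Σ_ω φ{ω} 1{N ↮ x, N ↮ v}(ω) · Cov_{φ_{u − cut_N(ω)}}(1_U(C_x), 1{S ↔ v})`.
[cite: Gladkov2024, Thm. 3.2 (p. 4)] [cite: VandenbergHaggstromKahn2005, Thm. 1.4 (p. 7), §2.1 Lemmas 2.3–2.4 (p. 10)]
[cite: Grimmett2006, Thm. (3.8)(b) (p. 39)] -/
theorem starH_indicator_rc (u : Sym2 V → unitInterval) {q : ℝ} (hq : 1 ≤ q) {x : V} (v : V) {S : Set V} (hxS : x ∈ S)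
    (N : Set V) (U : Set (Set (Sym2 V))) (hU : IsUpperSet U) :
    (∑ ω, rcMass u q ω * (ind {ω : BondConfig V | (∀ n ∈ N, ¬ (openGraph ω).Reachable n x) ∧
          ∀ n ∈ N, ¬ (openGraph ω).Reachable n v} ω *
        ((∑ η, rcMass (delW u (cut N ω)) q η * (U.indicator (1 : Set (Sym2 V) → ℝ) (openEdgeCluster η x) *
            ind {ζ : BondConfig V | ∃ s ∈ S, (openGraph ζ).Reachable s v} η)) -
          (∑ η, rcMass (delW u (cut N ω)) q η * U.indicator (1 : Set (Sym2 V) → ℝ) (openEdgeCluster η x)) *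
            (∑ η, rcMass (delW u (cut N ω)) q η * ind {ζ : BondConfig V | ∃ s ∈ S, (openGraph ζ).Reachable s v} η)))) *
        (rcMeasureW u q ∅).real {ζ : BondConfig V | ∃ s ∈ S, (openGraph ζ).Reachable s v}ᶜ ≤
      (rcMeasureW u q ∅).real ({ζ : BondConfig V | ∃ s ∈ S, (openGraph ζ).Reachable s v}ᶜ ∩
          {ζ : BondConfig V | ∃ n ∈ N, (openGraph ζ).Reachable n v}ᶜ) *
        ((rcMeasureW u q ∅).real ({η : BondConfig V | openEdgeCluster η x ∈ U} ∩
            {ζ : BondConfig V | ∃ s ∈ S, (openGraph ζ).Reachable s v}) -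
          (rcMeasureW u q ∅).real {η : BondConfig V | openEdgeCluster η x ∈ U} *
            (rcMeasureW u q ∅).real {ζ : BondConfig V | ∃ s ∈ S, (openGraph ζ).Reachable s v}) := by
  classical
  have hq0 : 0 < q := one_pos.trans_le hq
  haveI := isProbabilityMeasure_rcMeasureW u hq0 (∅ : Set V)
  rw [starH_sum_eq u hq0 x v S N U]
  set A : Set (BondConfig V) := {η : BondConfig V | openEdgeCluster η x ∈ U} with hA
  set Y : Set (BondConfig V) := {ζ : BondConfig V | ∃ s ∈ S, (openGraph ζ).Reachable s v} with hY
  set Nv : Set (BondConfig V) := {ζ : BondConfig V | ∃ n ∈ N, (openGraph ζ).Reachable n v} with hNv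
  set E : BondConfig V → Set (BondConfig V) := fun ω => {ζ | setCl ζ N = setCl ω N} with hE
  have hmeas : ∀ T : Set (BondConfig V), MeasurableSet T := fun _ => MeasurableSet.of_discrete
  have hn := fun (T : Set (BondConfig V)) => (measureReal_nonneg : 0 ≤ (rcMeasureW u q ∅).real T)
  have hAup : IsUpperSet A := fun ω ω' hle hω => hU (openEdgeCluster_mono hle x) hω
  have hYup : IsUpperSet Y := fun ω ω' hle ⟨s, hs, h⟩ => ⟨s, hs, h.mono (openGraph_mono hle)⟩
  have hNvup : IsUpperSet Nv := fun ω ω' hle ⟨n, hn', h⟩ => ⟨n, hn', h.mono (openGraph_mono hle)⟩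
  set F : Set (BondConfig V) := Y ∪ Nv with hF
  set cp : Set (BondConfig V) → BondConfig V → ℝ := fun T ω =>
    (rcMeasureW u q ∅).real (T ∩ E ω) / (rcMeasureW u q ∅).real (E ω) with hcp
  show ((rcMeasureW u q ∅).real (A ∩ Y) - ∑ ω, rcMass u q ω * (cp A ω * cp Y ω)) * (rcMeasureW u q ∅).real Yᶜ ≤ _
  have hmass : ∀ ω, (rcMeasureW u q ∅).real {ω} = rcMass u q ω := fun ω => by
    rw [rcMeasureW_real_singleton u hq0]; rfl
  have hEpos : ∀ ω, rcMass u q ω ≠ 0 → 0 < (rcMeasureW u q ∅).real (E ω) := by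
    intro ω hne
    have hle : (rcMeasureW u q ∅).real {ω} ≤ (rcMeasureW u q ∅).real (E ω) :=
      measureReal_mono (Set.singleton_subset_iff.2 rfl) (measure_ne_top _ _)
    rw [hmass] at hle
    exact lt_of_lt_of_le (lt_of_le_of_ne (rcMass_nonneg u hq0 ω) (Ne.symm hne)) hle
  -- `Nv ∩ Yᶜ` is a union of classes
  have hVN_class : ∀ ω ω' : BondConfig V, setCl ω' N = setCl ω N → (ω' ∈ Nv ∩ Yᶜ ↔ ω ∈ Nv ∩ Yᶜ) := by
    intro ω ω' hζ
    have hNv' : ω' ∈ Nv ↔ ω ∈ Nv := setReachable_iff_of_setCl_eq hζ v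
    constructor
    · rintro ⟨h1, h2⟩
      have h1' : ω ∈ Nv := hNv'.1 h1
      have hr := reachable_iff_of_setCl_eq_of_joined hζ h1'
      refine ⟨h1', fun hY' => h2 ?_⟩
      obtain ⟨s, hs, hsv⟩ := hY'
      exact ⟨s, hs, ((hr s).2 hsv.symm).symm⟩
    · rintro ⟨h1, h2⟩
      have hr := reachable_iff_of_setCl_eq_of_joined hζ h1
      refine ⟨hNv'.2 h1, fun hY' => h2 ?_⟩
      obtain ⟨s, hs, hsv⟩ := hY'
      exact ⟨s, hs, ((hr s).1 hsv.symm).symm⟩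
  have hcpY : ∀ ω, rcMass u q ω ≠ 0 → cp Y ω = cp F ω - ind (Nv ∩ Yᶜ) ω := by
    intro ω hne
    have hEp := hEpos ω hne
    have hFY : F ∩ E ω = (Y ∩ E ω) ∪ ((Nv ∩ Yᶜ) ∩ E ω) := by
      ext ζ
      simp only [hF, Set.mem_inter_iff, Set.mem_union, Set.mem_compl_iff]
      tauto
    have hdisj : Disjoint (Y ∩ E ω) ((Nv ∩ Yᶜ) ∩ E ω) := by
      rw [Set.disjoint_left]
      rintro ζ ⟨h1, -⟩ ⟨⟨-, h2⟩, -⟩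
      exact h2 h1
    have hVNE : (rcMeasureW u q ∅).real ((Nv ∩ Yᶜ) ∩ E ω) = ind (Nv ∩ Yᶜ) ω * (rcMeasureW u q ∅).real (E ω) := by
      by_cases hω : ω ∈ Nv ∩ Yᶜ
      · have : (Nv ∩ Yᶜ) ∩ E ω = E ω := by
          ext ζ; constructor
          · rintro ⟨-, h⟩; exact h
          · intro h; exact ⟨(hVN_class ω ζ h).2 hω, h⟩
        rw [this, ind_of_mem hω, one_mul]
      · have : (Nv ∩ Yᶜ) ∩ E ω = ∅ := by
          rw [Set.eq_empty_iff_forall_notMem]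
          rintro ζ ⟨h12, h3⟩; exact hω ((hVN_class ω ζ h3).1 h12)
        rw [this, ind_of_not_mem hω, measureReal_empty, zero_mul]
    simp only [hcp]
    rw [hFY, measureReal_union hdisj (hmeas _), hVNE]
    field_simp
    ring
  have hsum2 : ∑ ω, rcMass u q ω * (cp A ω * cp Y ω) =
      ∑ ω, rcMass u q ω * (cp A ω * cp F ω) - (rcMeasureW u q ∅).real (A ∩ (Nv ∩ Yᶜ)) := by
    have h := sum_rcMass_mul_condProb_key u hq0 (fun ζ : BondConfig V => setCl ζ N) A (fun ω => ind (Nv ∩ Yᶜ) ω)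
      (fun ω ω' hζ => by
        by_cases hω : ω ∈ Nv ∩ Yᶜ
        · rw [ind_of_mem hω, ind_of_mem ((hVN_class ω ω' hζ).2 hω)]
        · rw [ind_of_not_mem hω, ind_of_not_mem (fun h' => hω ((hVN_class ω ω' hζ).1 h'))])
    have e1 : ∑ ω, rcMass u q ω * (ind (Nv ∩ Yᶜ) ω * ind A ω) = (rcMeasureW u q ∅).real (A ∩ (Nv ∩ Yᶜ)) := by
      rw [rcMeasureW_real_eq_sum_rcMass u hq0]
      refine Finset.sum_congr rfl fun ω _ => ?_
      rw [ind_inter A (Nv ∩ Yᶜ)]; ring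
    rw [e1] at h
    rw [← h, ← Finset.sum_sub_distrib]
    refine Finset.sum_congr rfl fun ω _ => ?_
    by_cases hne : rcMass u q ω = 0
    · rw [hne]; ring
    · rw [hcpY ω hne]
      simp only [hcp]
      ring
  have hHarris : (rcMeasureW u q ∅).real A * (rcMeasureW u q ∅).real F ≤ ∑ ω, rcMass u q ω * (cp A ω * cp F ω) := by
    have hFup : IsUpperSet F := IsUpperSet.union hYup hNvup
    have h := setClusterHarris_rc u hq ∅ N.toFinset hAup hFup
    simp only [Set.coe_toFinset, hmass] at h
    refine le_of_le_of_eq h ?_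
    simp only [hcp]
    refine Finset.sum_congr rfl fun ω _ => ?_
    ring
  /- 4. vdBHK Thm 1.4 with the set `S` -/
  have hCPA : (rcMeasureW u q ∅).real (A ∩ (Nv ∩ Yᶜ)) * (rcMeasureW u q ∅).real Yᶜ ≤
      (rcMeasureW u q ∅).real (Nv ∩ Yᶜ) * (rcMeasureW u q ∅).real (A ∩ Yᶜ) :=
    real_clusterEvent_setReach_mul_le u hq v hxS N U hU
  /- 5. assembly -/
  rw [hsum2]
  have hFsplit : (rcMeasureW u q ∅).real F = (rcMeasureW u q ∅).real Y + (rcMeasureW u q ∅).real (Nv ∩ Yᶜ) := by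
    have hFY : F = Y ∪ (Nv ∩ Yᶜ) := by
      ext ζ; simp only [hF, Set.mem_union, Set.mem_inter_iff, Set.mem_compl_iff]; tauto
    have hdisj : Disjoint Y (Nv ∩ Yᶜ) := by
      rw [Set.disjoint_left]; rintro ζ h1 ⟨-, h2⟩; exact h2 h1
    rw [hFY, measureReal_union hdisj (hmeas _)]
  have hAN : (rcMeasureW u q ∅).real (A ∩ Yᶜ) = (rcMeasureW u q ∅).real A - (rcMeasureW u q ∅).real (A ∩ Y) := by
    have := measureReal_inter_add_sdiff (μ := rcMeasureW u q ∅) (s := A) (h := measure_ne_top _ _) (hmeas Y)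
    rw [Set.sdiff_eq_compl_inter, Set.inter_comm Yᶜ A] at this
    linarith
  have hNY : (rcMeasureW u q ∅).real Yᶜ = 1 - (rcMeasureW u q ∅).real Y := by
    have := measureReal_compl (μ := rcMeasureW u q ∅) (hmeas Y)
    rw [probReal_univ] at this
    exact this
  have hYN : (rcMeasureW u q ∅).real (Yᶜ ∩ Nvᶜ) = (rcMeasureW u q ∅).real Yᶜ - (rcMeasureW u q ∅).real (Nv ∩ Yᶜ) := by
    have := measureReal_inter_add_sdiff (μ := rcMeasureW u q ∅) (s := Yᶜ) (h := measure_ne_top _ _) (hmeas Nv)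
    rw [Set.sdiff_eq_compl_inter, Set.inter_comm Nvᶜ Yᶜ, Set.inter_comm Yᶜ Nv] at this
    linarith
  rw [hFsplit] at hHarris
  rw [hYN]
  -- abbreviate
  set a := (rcMeasureW u q ∅).real (A ∩ Y) with ha
  set pA := (rcMeasureW u q ∅).real A
  set pY := (rcMeasureW u q ∅).real Y
  set pN := (rcMeasureW u q ∅).real Yᶜ
  set pVN := (rcMeasureW u q ∅).real (Nv ∩ Yᶜ)
  set c := (rcMeasureW u q ∅).real (A ∩ (Nv ∩ Yᶜ))
  set T := ∑ ω, rcMass u q ω * (cp A ω * cp F ω)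
  have hpN : 0 ≤ pN := hn _
  have hT : pA * (pY + pVN) ≤ T := hHarris
  have hc : c * pN ≤ pVN * (pA - a) := by rw [← hAN]; exact hCPA
  have h1 : (a - (T - c)) * pN ≤ (a - pA * pY - pA * pVN) * pN + c * pN := by
    have := mul_le_mul_of_nonneg_right hT hpN
    nlinarith [this]
  calc (a - (T - c)) * pN ≤ (a - pA * pY - pA * pVN) * pN + c * pN := h1
    _ ≤ (a - pA * pY - pA * pVN) * pN + pVN * (pA - a) := by linarith
    _ = (pN - pVN) * (a - pA * pY) := by rw [hNY]; ring
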